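import Literature.NumberTheory.LFunctions.WeilLineSupSampling
import Literature.NumberTheory.LFunctions.WeilLineSamplingBessel
import HarnessLib

/-!
# Duffin–Schaeffer frames of exponentials in Weil vocabulary

**Theorem I of Duffin–Schaeffer (1952)**, rescaled to density `d` and stated on the dense
subspace of smooth windows: if `λ : ℤ → ℝ` is a real sequence of uniform density `d`
(`|λ_n - n/d| ≤ M`, `|λ_m - λ_n| ≥ s > 0` for `m ≠ n`) and `0 < a < π d`, then there are
constants `0 < A ≤ B` such that for every Weil test function `g` supported in `[-a, a]`

  `A ∫ |g|² ≤ Σ_n |ĝ(1/2 + iλ_n)|² ≤ B ∫ |g|²`,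

the series being summable (`weilMellin_line_frame`; `ĝ(1/2 + it) = ∫ g(u) e^{itu} du`). In
frame language: the exponentials `{e^{iλ_n u}}` form a frame for `L²(-a, a)`.

* The upper (Bessel) bound and summability are `WeilLineSamplingBessel` (Plancherel–Pólya via the
  cell Sobolev inequality).
* The lower bound (`weilMellin_line_frame_lower`) is Duffin–Schaeffer's reduction of the `L²`
  inequality to the sup-norm sampling inequality `WeilLineSupSampling` on the slightly longer
  window `b = (a + πd)/2`: for a bump `h` supported in `[-(b-a), b-a]` and `x ∈ ℝ`, the window
  `G_x = g ⋆ (h e^{-ix·})` has `Ĝ_x(1/2+iy) = ĝ(1/2+iy) ĥ(1/2+i(y-x))`, so sampling `G_x` at `x`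
  gives `|ĝ(x)|² |ĥ(1/2)|² ≤ K² Σ_n |ĝ(λ_n)|² |ĥ(λ_n - x)|²`
  (`norm_sq_weilMellin_line_le_tsum_of_supSampling`); integrating in `x` (Tonelli, Plancherel
  for `g` and `h`) yields `|ĥ(1/2)|² ‖g‖₂² ≤ K² ‖h‖₂² Σ_n |ĝ(λ_n)|²`.

Sources: R. J. Duffin, A. C. Schaeffer, *A class of nonharmonic Fourier series*, Trans. AMS 72
(1952) 341–366, Theorem I and Lemma IV; R. M. Young, *An Introduction to Nonharmonic Fourier
Series* (2001), Ch. 4; K. Seip (1995) for the sharp density form (not needed here).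
Everything is proved; no definitions, no named facts.
-/

noncomputable section

open Complex Set MeasureTheory Filter Metric
open scoped Real Topology Pointwise ENNReal

namespace Literature.NumberTheory.LFunctions

/-! ### The pointwise inequality from sup-norm sampling -/

/-- **Duffin–Schaeffer's localisation.** If sup-norm sampling with constant `K` holds for
windows supported in `[-b, b]` on the sequence `λ`, then for Weil tests `g` (support `[-a, a]`)
and `h` (support `[-η, η]`, `a + η ≤ b`) and every real `x`:
`|ĥ(1/2)|² |ĝ(1/2+ix)|² ≤ K² Σ_n |ĝ(1/2+iλ_n)|² |ĥ(1/2+i(λ_n - x))|²`.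
[cite: DuffinSchaeffer1952, proof of Theorem I] -/
theorem norm_sq_weilMellin_line_le_tsum_of_supSampling {K b : ℝ} {Λ : ℤ → ℝ}
    (hsup : ∀ (G : ℝ → ℂ), IsWeilTest G → tsupport G ⊆ Icc (-b) b →
      ∀ B : ℝ, (∀ n, ‖weilMellin G (1 / 2 + Λ n * I)‖ ≤ B) →
      ∀ x : ℝ, ‖weilMellin G (1 / 2 + x * I)‖ ≤ K * B)
    {g h : ℝ → ℂ} (hg : IsWeilTest g) (hh : IsWeilTest h) {a η : ℝ}
    (hga : tsupport g ⊆ Icc (-a) a) (hhs : tsupport h ⊆ Icc (-η) η) (hab : a + η ≤ b)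
    (hsum : Summable fun n => ‖weilMellin g (1 / 2 + Λ n * I)‖ ^ 2) (x : ℝ) :
    ‖weilMellin h (1 / 2)‖ ^ 2 * ‖weilMellin g (1 / 2 + x * I)‖ ^ 2 ≤
      K ^ 2 * ∑' n, ‖weilMellin g (1 / 2 + Λ n * I)‖ ^ 2 *
        ‖weilMellin h (1 / 2 + ((Λ n - x : ℝ) : ℂ) * I)‖ ^ 2 := by
  -- the modulated bump and the localised window
  set hx : ℝ → ℂ := fun u => h u * cexp ((-x * u : ℝ) * I) with hhx
  have hhxt : IsWeilTest hx := isWeilTest_mul_cexp_ofReal_mul_I hh (-x)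
  have hhxs : tsupport hx ⊆ Icc (-η) η := (tsupport_mul_cexp_subset h (-x)).trans hhs
  set G : ℝ → ℂ := weilConv g hx with hG
  have hGt : IsWeilTest G := hg.weilConv hhxt
  have hGs : tsupport G ⊆ Icc (-b) b :=
    ((tsupport_weilConv_subset hg.2).trans ((add_subset_add hga hhxs).trans
      (Icc_add_Icc_subset_symm a η))).trans (Icc_subset_Icc (by linarith) hab)
  have hGM : ∀ y : ℝ, weilMellin G (1 / 2 + y * I) =
      weilMellin g (1 / 2 + y * I) * weilMellin h (1 / 2 + ((y - x : ℝ) : ℂ) * I) := by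
    intro y
    rw [hG, weilMellin_weilConv_holds hg.1.continuous hg.2 hhxt.1.continuous hhxt.2, hhx,
      weilMellin_mul_cexp_ofReal_mul_I_half, ← sub_eq_add_neg]
  -- the `ℓ²` bound for the samples of `G`
  set c : ℤ → ℝ := fun n => ‖weilMellin g (1 / 2 + Λ n * I)‖ ^ 2 with hc
  set e : ℤ → ℝ := fun n => ‖weilMellin h (1 / 2 + ((Λ n - x : ℝ) : ℂ) * I)‖ ^ 2 with he
  have hNh := fun y : ℝ => norm_weilMellin_line_le_integral_norm hh.1.continuous hh.2 y
  have hce : Summable fun n => c n * e n := by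
    refine Summable.of_nonneg_of_le (fun n => mul_nonneg (sq_nonneg _) (sq_nonneg _))
      (fun n => mul_le_mul_of_nonneg_left ?_ (sq_nonneg _)) (hsum.mul_right ((∫ t, ‖h t‖) ^ 2))
    exact pow_le_pow_left₀ (norm_nonneg _) (hNh _) 2
  set T : ℝ := ∑' n, c n * e n with hT
  have hT0 : 0 ≤ T := tsum_nonneg fun n => mul_nonneg (sq_nonneg _) (sq_nonneg _)
  have hB : ∀ n, ‖weilMellin G (1 / 2 + Λ n * I)‖ ≤ Real.sqrt T := by
    intro n
    rw [← Real.sqrt_sq (norm_nonneg _), hGM, norm_mul, mul_pow]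
    exact Real.sqrt_le_sqrt (hce.le_tsum n fun j _ => mul_nonneg (sq_nonneg _) (sq_nonneg _))
  -- sample at `x`
  have key := hsup G hGt hGs (Real.sqrt T) hB x
  rw [hGM, sub_self, Complex.ofReal_zero, zero_mul, add_zero, norm_mul] at key
  have hK : 0 ≤ K * Real.sqrt T := (mul_nonneg (norm_nonneg _) (norm_nonneg _)).trans key
  have key2 := pow_le_pow_left₀ (by positivity) key 2
  rw [mul_pow, mul_pow, Real.sq_sqrt hT0] at key2
  linarith [key2]

/-! ### The lower frame bound -/

/-- **Duffin–Schaeffer's lower frame bound** (Theorem I of Duffin–Schaeffer 1952, lower half,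
rescaled to density `d`): for `0 < a < π d`, `s > 0` and `M` there is `A > 0` with
`A ∫|g|² ≤ Σ_n |ĝ(1/2 + iλ_n)|²` for every real `s`-separated `λ` with `|λ_n - n/d| ≤ M` and
every Weil test `g` supported in `[-a, a]`. [cite: DuffinSchaeffer1952, Theorem I] -/
theorem weilMellin_line_frame_lower {d s a : ℝ} (M : ℝ) (hd : 0 < d) (hs : 0 < s) (ha : 0 < a)
    (had : a < π * d) :
    ∃ A : ℝ, 0 < A ∧ ∀ (Λ : ℤ → ℝ), (∀ n, |Λ n - n / d| ≤ M) →
      (Pairwise fun m n => s ≤ |Λ m - Λ n|) →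
      ∀ g : ℝ → ℂ, IsWeilTest g → tsupport g ⊆ Icc (-a) a →
        A * ∫ u, ‖g u‖ ^ 2 ≤ ∑' n, ‖weilMellin g (1 / 2 + Λ n * I)‖ ^ 2 := by
  -- the longer window and the sup-norm sampling constant
  set b : ℝ := (a + π * d) / 2 with hb
  have hb0 : 0 < b := by rw [hb]; positivity
  have hbd : b < π * d := by rw [hb]; linarith
  set η : ℝ := b - a with hη
  have hη0 : 0 < η := by rw [hη, hb]; linarith
  obtain ⟨K, hK, hsup⟩ := exists_norm_weilMellin_line_le_mul_of_uniformDensity M hd hs hb0 hbd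
  -- the bump `h` and its constants
  obtain ⟨h, hh, hhs, hh0⟩ := exists_isWeilTest_bump_weilMellin_half_ne_zero hη0
  set c₀ : ℝ := ‖weilMellin h (1 / 2)‖ with hc₀
  have hc₀0 : 0 < c₀ := norm_pos_iff.2 hh0
  set Nh : ℝ := weilNorm2Sq h with hNh
  have hNh0 : 0 < Nh := by
    rcases (weilNorm2Sq_nonneg h).eq_or_lt with h0 | h0
    · exfalso
      have : h = 0 := hh.eq_zero_of_integral_norm_sq_eq_zero (by rw [weilNorm2Sq] at h0; linarith)
      apply hh0
      simp [this, weilMellin]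
    · exact h0
  set eh : ℝ → ℝ := fun y => ‖weilMellin h (1 / 2 + y * I)‖ ^ 2 with heh
  have heh_int : Integrable eh := integrable_norm_sq_weilMellin_half_line hh
  have heh_val : ∫ y, eh y = 2 * π * Nh := integral_norm_sq_weilMellin_half_line hh
  have heh_cont : Continuous eh := continuous_norm_sq_weilMellin_half_line hh
  have heh_nn : ∀ y, 0 ≤ eh y := fun y => sq_nonneg _
  refine ⟨c₀ ^ 2 / (K ^ 2 * Nh), by positivity, fun Λ hΛ hsep g hg hga => ?_⟩
  have hsum : Summable fun n => ‖weilMellin g (1 / 2 + Λ n * I)‖ ^ 2 :=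
    summable_norm_sq_weilMellin_line_of_separated hs hsep hg
  set c : ℤ → ℝ := fun n => ‖weilMellin g (1 / 2 + Λ n * I)‖ ^ 2 with hc
  have hc0 : ∀ n, 0 ≤ c n := fun n => sq_nonneg _
  set S : ℝ := ∑' n, c n with hS
  have hS0 : 0 ≤ S := tsum_nonneg hc0
  -- the pointwise inequality
  have hpt : ∀ x : ℝ, c₀ ^ 2 * ‖weilMellin g (1 / 2 + x * I)‖ ^ 2 ≤
      K ^ 2 * ∑' n, c n * eh (Λ n - x) := fun x =>
    norm_sq_weilMellin_line_le_tsum_of_supSampling (hsup Λ hΛ hsep) hg hh hga hhs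
      (by rw [hη]; linarith) hsum x
  -- the terms `F n x = c n · eh (λ_n - x)`: nonnegative, integrable, with integral `c n · 2π Nh`
  set F : ℤ → ℝ → ℝ := fun n x => c n * eh (Λ n - x) with hF
  have hFnn : ∀ n x, 0 ≤ F n x := fun n x => mul_nonneg (hc0 n) (heh_nn _)
  have hFint : ∀ n, Integrable (F n) := fun n =>
    (heh_int.comp_sub_left (Λ n)).const_mul (c n)
  have hFval : ∀ n, ∫ x, F n x = c n * (2 * π * Nh) := by
    intro n
    simp only [hF]
    rw [integral_const_mul, integral_sub_left_eq_self eh volume (Λ n), heh_val]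
  have hFsum : ∀ x, Summable fun n => F n x := by
    intro x
    refine Summable.of_nonneg_of_le (fun n => hFnn n x)
      (fun n => mul_le_mul_of_nonneg_left ?_ (hc0 n)) (hsum.mul_right ((∫ t, ‖h t‖) ^ 2))
    exact pow_le_pow_left₀ (norm_nonneg _)
      (norm_weilMellin_line_le_integral_norm hh.1.continuous hh.2 _) 2
  have hFmeas : ∀ n, AEMeasurable (fun x => ENNReal.ofReal (F n x)) :=
    fun n => ((heh_cont.comp (continuous_const.sub continuous_id)).const_mul
      (c n)).measurable.ennreal_ofReal.aemeasurable
  -- integrate the pointwise inequality (Tonelli in `ℝ≥0∞`)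
  have hgi : Integrable fun x : ℝ => c₀ ^ 2 * ‖weilMellin g (1 / 2 + x * I)‖ ^ 2 :=
    (integrable_norm_sq_weilMellin_half_line hg).const_mul _
  have hLHS : ∫ x : ℝ, c₀ ^ 2 * ‖weilMellin g (1 / 2 + x * I)‖ ^ 2 =
      c₀ ^ 2 * (2 * π * weilNorm2Sq g) := by
    rw [integral_const_mul, integral_norm_sq_weilMellin_half_line hg]
  have hmono : ∫⁻ x : ℝ, ENNReal.ofReal (c₀ ^ 2 * ‖weilMellin g (1 / 2 + x * I)‖ ^ 2) ≤
      ∫⁻ x : ℝ, ENNReal.ofReal (K ^ 2 * ∑' n, F n x) :=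
    lintegral_mono fun x => ENNReal.ofReal_le_ofReal (hpt x)
  have hL : ∫⁻ x : ℝ, ENNReal.ofReal (c₀ ^ 2 * ‖weilMellin g (1 / 2 + x * I)‖ ^ 2) =
      ENNReal.ofReal (c₀ ^ 2 * (2 * π * weilNorm2Sq g)) := by
    rw [← hLHS, ofReal_integral_eq_lintegral_ofReal hgi
      (Eventually.of_forall fun x => by positivity)]
  have hR : ∫⁻ x : ℝ, ENNReal.ofReal (K ^ 2 * ∑' n, F n x) =
      ENNReal.ofReal (K ^ 2 * (S * (2 * π * Nh))) := by
    have e1 : ∀ x, ENNReal.ofReal (K ^ 2 * ∑' n, F n x) =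
        ENNReal.ofReal (K ^ 2) * ∑' n, ENNReal.ofReal (F n x) := fun x => by
      rw [ENNReal.ofReal_mul (sq_nonneg K), ENNReal.ofReal_tsum_of_nonneg (fun n => hFnn n x)
        (hFsum x)]
    simp_rw [e1]
    rw [lintegral_const_mul' _ _ ENNReal.ofReal_ne_top, lintegral_tsum hFmeas]
    have e2 : ∀ n, ∫⁻ x, ENNReal.ofReal (F n x) = ENNReal.ofReal (c n * (2 * π * Nh)) := fun n => by
      rw [← hFval n, ofReal_integral_eq_lintegral_ofReal (hFint n)
        (Eventually.of_forall fun x => hFnn n x)]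
    simp_rw [e2]
    rw [← ENNReal.ofReal_tsum_of_nonneg (fun n => by positivity) (hsum.mul_right _),
      tsum_mul_right, ← ENNReal.ofReal_mul (sq_nonneg K)]
  rw [hL, hR, ENNReal.ofReal_le_ofReal_iff (by positivity)] at hmono
  -- `c₀² · 2π ‖g‖² ≤ K² · S · 2π Nh`
  have hπ : 0 < 2 * π := by positivity
  have h1 : c₀ ^ 2 * weilNorm2Sq g ≤ K ^ 2 * Nh * S := by nlinarith
  rw [weilNorm2Sq] at h1
  calc c₀ ^ 2 / (K ^ 2 * Nh) * ∫ u, ‖g u‖ ^ 2 = (c₀ ^ 2 * ∫ u, ‖g u‖ ^ 2) / (K ^ 2 * Nh) := by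
        ring
    _ ≤ (K ^ 2 * Nh * S) / (K ^ 2 * Nh) := by gcongr
    _ = S := by field_simp

/-! ### The frame theorem -/

/-- **Duffin–Schaeffer frames of exponentials (Theorem I of Duffin–Schaeffer 1952) in Weil
vocabulary.** If `λ : ℤ → ℝ` satisfies `|λ_n - n/d| ≤ M` and `|λ_m - λ_n| ≥ s > 0` (`m ≠ n`),
and `0 < a < π d`, there are `0 < A ≤ B` such that for every Weil test `g` supported in
`[-a, a]` the samples `|ĝ(1/2 + iλ_n)|²` are summable and
`A ∫|g|² ≤ Σ_n |ĝ(1/2 + iλ_n)|² ≤ B ∫|g|²`. [cite: DuffinSchaeffer1952, Theorem I] -/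
theorem weilMellin_line_frame (Λ : ℤ → ℝ) (d M s a : ℝ) (hd : 0 < d) (hs : 0 < s) (ha : 0 < a)
    (had : a < π * d) (hΛ : ∀ n, |Λ n - n / d| ≤ M) (hsep : ∀ m n, m ≠ n → s ≤ |Λ m - Λ n|) :
    ∃ A B : ℝ, 0 < A ∧ A ≤ B ∧
      ∀ g : ℝ → ℂ, IsWeilTest g → tsupport g ⊆ Icc (-a) a →
        Summable (fun n => ‖weilMellin g (1 / 2 + Λ n * I)‖ ^ 2) ∧
        A * ∫ u, ‖g u‖ ^ 2 ≤ ∑' n, ‖weilMellin g (1 / 2 + Λ n * I)‖ ^ 2 ∧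
        ∑' n, ‖weilMellin g (1 / 2 + Λ n * I)‖ ^ 2 ≤ B * ∫ u, ‖g u‖ ^ 2 := by
  have hsep' : Pairwise fun m n => s ≤ |Λ m - Λ n| := fun m n hmn => hsep m n hmn
  obtain ⟨A, hA, hlow⟩ := weilMellin_line_frame_lower M hd hs ha had
  set B₀ : ℝ := ((⌊1 / s⌋₊ + 1 : ℕ) : ℝ) * (2 * π * (2 + a ^ 2)) with hB₀
  refine ⟨A, max A B₀, hA, le_max_left _ _, fun g hg hga => ⟨?_, hlow Λ hΛ hsep' g hg hga, ?_⟩⟩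
  · exact summable_norm_sq_weilMellin_line_of_separated hs hsep' hg
  · have h1 := tsum_norm_sq_weilMellin_line_le_of_separated hs hsep' hg hga
    have h2 : 0 ≤ ∫ u, ‖g u‖ ^ 2 := integral_nonneg fun _ => by positivity
    exact h1.trans (mul_le_mul_of_nonneg_right (le_max_right _ _) h2)

end Literature.NumberTheory.LFunctions

end
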